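import Summits.NavierStokesRegularity.FunctionalMining.VelocityL4HalfRoot
import HarnessLib

/-!
# FunctionalMining — the cube-root map `w ↦ w/‖w‖^{2/3}` is `⅓`-Hölder, and the mean of `‖u‖²u` is
# controlled by its oscillation when `∫ u = 0` (tools for the nonlinear Poincaré inequality at `a = 2`)

search for candidate a priori estimates; no regularity claim. Cell `pub-nsfunc`, prove seat
(gen 8). Static, elementary facts; nothing here concerns Navier–Stokes solutions. Companion of
`VelocityL4HalfRoot` (the case `a = 1`) and of `VelocityL6NonlinearPoincare` (the inequality
`∫|u|⁶ ≤ C∫|u|⁴|∇u|²` for zero-mean fields, the coercive step of the `L⁶` velocity-moment law,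
K0 row `EV.s=6|T_LD|G1`).

* `cbrt_add_le`, `abs_cbrt_sub_cbrt_le` — `(p+q)^{1/3} ≤ p^{1/3} + q^{1/3}`, `|A^{1/3} − B^{1/3}| ≤ |A−B|^{1/3}`.
* `norm_cubeRootMap_sub_le` — for `g(w) = ‖w‖^{1/3} · (w/‖w‖)` (the inverse of `u ↦ ‖u‖²u`,
  `cubeRootMap_normSq_smul`): `‖g a − g b‖ ≤ 3 ‖a − b‖^{1/3}`.
* `integral_cbrt_le` — Jensen `∫ f^{1/3} ≤ (∫ f)^{1/3}` on `T^d` (from `f^{1/3} ≤ f/(3t²) + 2t/3`).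
* `norm_sq_integral_normSq_smul_le` — **mean control**: for a continuous zero-mean field `u`,
  `W := ‖u‖²u`, `c := ∫W`: `‖c‖² ≤ 729 ∫‖W − c‖²`.
[ours; elementary]
-/

noncomputable section

open MeasureTheory Finset
open scoped InnerProductSpace RealInnerProductSpace

namespace Summit.NavierStokesRegularity.FunctionalMining

open Literature.Analysis.FunctionSpaces Literature.Analysis.FunctionSpaces.Torus

namespace VelocityL6

/-! ## 1. Cube roots -/

section Cbrt

/-- `(x^{1/3})³ = x` for `x ≥ 0` (private copy; the same statement is
`Literature.NumberTheory.DiophantineGeometry.rpow_third_pow_three`, not imported here). [folklore] -/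
private theorem cbrt_pow_three {x : ℝ} (hx : 0 ≤ x) : (x ^ ((3 : ℝ)⁻¹)) ^ 3 = x := by
  have h := Real.rpow_inv_natCast_pow hx (n := 3) (by norm_num)
  simpa using h

/-- `(x³)^{1/3} = x` for `x ≥ 0`. [folklore] -/
private theorem pow_three_cbrt {x : ℝ} (hx : 0 ≤ x) : (x ^ 3) ^ ((3 : ℝ)⁻¹) = x := by
  have h := Real.pow_rpow_inv_natCast hx (n := 3) (by norm_num)
  simpa using h

/-- Subadditivity of the cube root: `(p + q)^{1/3} ≤ p^{1/3} + q^{1/3}` for `p, q ≥ 0`. [folklore] -/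
theorem cbrt_add_le {p q : ℝ} (hp : 0 ≤ p) (hq : 0 ≤ q) :
    (p + q) ^ ((3 : ℝ)⁻¹) ≤ p ^ ((3 : ℝ)⁻¹) + q ^ ((3 : ℝ)⁻¹) := by
  set α := p ^ ((3 : ℝ)⁻¹) with hα
  set β := q ^ ((3 : ℝ)⁻¹) with hβ
  have hα0 : 0 ≤ α := Real.rpow_nonneg hp _
  have hβ0 : 0 ≤ β := Real.rpow_nonneg hq _
  have hα3 : α ^ 3 = p := cbrt_pow_three hp
  have hβ3 : β ^ 3 = q := cbrt_pow_three hq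
  have hsum : p + q ≤ (α + β) ^ 3 := by
    rw [← hα3, ← hβ3]; nlinarith [mul_nonneg hα0 hβ0, mul_nonneg (mul_nonneg hα0 hβ0) (add_nonneg hα0 hβ0)]
  calc (p + q) ^ ((3 : ℝ)⁻¹) ≤ ((α + β) ^ 3) ^ ((3 : ℝ)⁻¹) :=
        Real.rpow_le_rpow (by positivity) hsum (by norm_num)
    _ = α + β := pow_three_cbrt (by positivity)

/-- `|A^{1/3} − B^{1/3}| ≤ |A − B|^{1/3}` for `A, B ≥ 0`. [folklore] -/
theorem abs_cbrt_sub_cbrt_le {A B : ℝ} (hA : 0 ≤ A) (hB : 0 ≤ B) :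
    |A ^ ((3 : ℝ)⁻¹) - B ^ ((3 : ℝ)⁻¹)| ≤ |A - B| ^ ((3 : ℝ)⁻¹) := by
  have key : ∀ {A B : ℝ}, 0 ≤ A → 0 ≤ B →
      A ^ ((3 : ℝ)⁻¹) ≤ B ^ ((3 : ℝ)⁻¹) + |A - B| ^ ((3 : ℝ)⁻¹) := by
    intro A B hA hB
    have h1 : A ≤ B + |A - B| := by have := le_abs_self (A - B); linarith
    calc A ^ ((3 : ℝ)⁻¹) ≤ (B + |A - B|) ^ ((3 : ℝ)⁻¹) :=
          Real.rpow_le_rpow hA h1 (by norm_num)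
      _ ≤ B ^ ((3 : ℝ)⁻¹) + |A - B| ^ ((3 : ℝ)⁻¹) := cbrt_add_le hB (abs_nonneg _)
  rw [abs_sub_le_iff]
  constructor
  · have := key hA hB; linarith
  · have := key hB hA; rw [abs_sub_comm] at this; linarith

end Cbrt

/-! ## 2. The cube-root map `g(w) = ‖w‖^{1/3} · w/‖w‖` -/

section CubeRootMap

variable {E : Type*} [NormedAddCommGroup E] [InnerProductSpace ℝ E]

omit [InnerProductSpace ℝ E] in
/-- `‖g(w)‖ = ‖w‖^{1/3}`. [ours] -/
theorem norm_cubeRootMap [NormedSpace ℝ E] (w : E) :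
    ‖(‖w‖ ^ ((3 : ℝ)⁻¹)) • ((‖w‖)⁻¹ • w)‖ = ‖w‖ ^ ((3 : ℝ)⁻¹) := by
  by_cases hw : w = 0
  · simp [hw]
  · have hn : 0 < ‖w‖ := norm_pos_iff.2 hw
    rw [norm_smul, norm_smul, norm_inv, norm_norm, inv_mul_cancel₀ hn.ne', mul_one,
      Real.norm_of_nonneg (Real.rpow_nonneg hn.le _)]

/-- `g(‖u‖² u) = u`. [ours] -/
theorem cubeRootMap_normSq_smul (u : E) :
    (‖‖u‖ ^ 2 • u‖ ^ ((3 : ℝ)⁻¹)) • ((‖‖u‖ ^ 2 • u‖)⁻¹ • (‖u‖ ^ 2 • u)) = u := by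
  by_cases hu : u = 0
  · simp [hu]
  · have hn : 0 < ‖u‖ := norm_pos_iff.2 hu
    have hn3 : ‖‖u‖ ^ 2 • u‖ = ‖u‖ ^ 3 := by
      rw [norm_smul, Real.norm_of_nonneg (sq_nonneg _)]; ring
    rw [hn3, pow_three_cbrt hn.le, smul_smul, smul_smul]
    have : ‖u‖ * (‖u‖ ^ 3)⁻¹ * ‖u‖ ^ 2 = 1 := by field_simp
    rw [this, one_smul]

/-- **The cube-root map is `⅓`-Hölder**: `‖g a − g b‖ ≤ 3 ‖a − b‖^{1/3}`. [ours; elementary] -/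
theorem norm_cubeRootMap_sub_le (a b : E) :
    ‖(‖a‖ ^ ((3 : ℝ)⁻¹)) • ((‖a‖)⁻¹ • a) - (‖b‖ ^ ((3 : ℝ)⁻¹)) • ((‖b‖)⁻¹ • b)‖ ≤
      3 * ‖a - b‖ ^ ((3 : ℝ)⁻¹) := by
  have h0 : 0 ≤ ‖a - b‖ ^ ((3 : ℝ)⁻¹) := Real.rpow_nonneg (norm_nonneg _) _
  by_cases hb : b = 0
  · subst hb
    rw [smul_zero, smul_zero, sub_zero, sub_zero, norm_cubeRootMap]
    linarith [Real.rpow_nonneg (norm_nonneg a) ((3 : ℝ)⁻¹)]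
  by_cases ha : a = 0
  · subst ha
    rw [smul_zero, smul_zero, zero_sub, norm_neg, norm_cubeRootMap, zero_sub, norm_neg]
    linarith [Real.rpow_nonneg (norm_nonneg b) ((3 : ℝ)⁻¹)]
  have hA : 0 < ‖a‖ := norm_pos_iff.2 ha
  have hB : 0 < ‖b‖ := norm_pos_iff.2 hb
  set x := ‖a‖ ^ ((3 : ℝ)⁻¹) with hx
  set y := ‖b‖ ^ ((3 : ℝ)⁻¹) with hy
  set δ := ‖a - b‖ ^ ((3 : ℝ)⁻¹) with hδ
  have hx0 : 0 ≤ x := Real.rpow_nonneg hA.le _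
  have hy0 : 0 < y := Real.rpow_pos_of_pos hB _
  have hy3 : y ^ 3 = ‖b‖ := cbrt_pow_three hB.le
  have hδ3 : δ ^ 3 = ‖a - b‖ := cbrt_pow_three (norm_nonneg _)
  -- split: `(x − y) â + y (â − b̂)`
  have hsplit : x • ((‖a‖)⁻¹ • a) - y • ((‖b‖)⁻¹ • b) =
      (x - y) • ((‖a‖)⁻¹ • a) + y • ((‖a‖)⁻¹ • a - (‖b‖)⁻¹ • b) := by
    rw [sub_smul, smul_sub]; abel
  rw [hsplit]
  have hunit : ‖(‖a‖)⁻¹ • a‖ = 1 := by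
    rw [norm_smul, norm_inv, norm_norm, inv_mul_cancel₀ hA.ne']
  -- first piece
  have h1 : ‖(x - y) • ((‖a‖)⁻¹ • a)‖ ≤ δ := by
    rw [norm_smul, hunit, mul_one, Real.norm_eq_abs, hx, hy, hδ]
    calc |‖a‖ ^ ((3 : ℝ)⁻¹) - ‖b‖ ^ ((3 : ℝ)⁻¹)| ≤ |‖a‖ - ‖b‖| ^ ((3 : ℝ)⁻¹) :=
          abs_cbrt_sub_cbrt_le (norm_nonneg _) (norm_nonneg _)
      _ ≤ ‖a - b‖ ^ ((3 : ℝ)⁻¹) :=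
          Real.rpow_le_rpow (abs_nonneg _) (abs_norm_sub_norm_le a b) (by norm_num)
  -- second piece
  have h2 : ‖y • ((‖a‖)⁻¹ • a - (‖b‖)⁻¹ • b)‖ ≤ 2 * δ := by
    rw [norm_smul, Real.norm_of_nonneg hy0.le]
    rcases le_or_gt ‖a - b‖ ‖b‖ with hle | hgt
    · have hu := VelocityL4.norm_unit_sub_unit_le ha hb
      -- `δ ≤ y` and `y · 2‖a−b‖/‖b‖ = 2 δ³ y / y³ ≤ 2 δ`
      have hδy : δ ≤ y := by
        rw [hδ, hy]; exact Real.rpow_le_rpow (norm_nonneg _) hle (by norm_num)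
      have hδ0 : 0 ≤ δ := h0
      have key : δ ^ 3 * y ≤ δ * y ^ 3 := by nlinarith [mul_nonneg hδ0 hy0.le, mul_nonneg (mul_nonneg hδ0 hy0.le) (add_nonneg hδ0 hy0.le)]
      calc y * ‖(‖a‖)⁻¹ • a - (‖b‖)⁻¹ • b‖ ≤ y * (2 * ‖a - b‖ / ‖b‖) :=
            mul_le_mul_of_nonneg_left hu hy0.le
        _ = 2 * (δ ^ 3 * y) / y ^ 3 := by rw [hδ3, hy3]; ring
        _ ≤ 2 * (δ * y ^ 3) / y ^ 3 := by gcongr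
        _ = 2 * δ := by field_simp
    · have hu : ‖(‖a‖)⁻¹ • a - (‖b‖)⁻¹ • b‖ ≤ 2 := by
        have hunit' : ‖(‖b‖)⁻¹ • b‖ = 1 := by
          rw [norm_smul, norm_inv, norm_norm, inv_mul_cancel₀ hB.ne']
        calc ‖(‖a‖)⁻¹ • a - (‖b‖)⁻¹ • b‖ ≤ ‖(‖a‖)⁻¹ • a‖ + ‖(‖b‖)⁻¹ • b‖ := norm_sub_le _ _
          _ = 2 := by rw [hunit, hunit']; norm_num
      have hyδ : y ≤ δ := by
        rw [hδ, hy]; exact Real.rpow_le_rpow (norm_nonneg _) hgt.le (by norm_num)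
      calc y * ‖(‖a‖)⁻¹ • a - (‖b‖)⁻¹ • b‖ ≤ δ * 2 :=
            mul_le_mul hyδ hu (norm_nonneg _) h0
        _ = 2 * δ := by ring
  calc ‖(x - y) • ((‖a‖)⁻¹ • a) + y • ((‖a‖)⁻¹ • a - (‖b‖)⁻¹ • b)‖
      ≤ ‖(x - y) • ((‖a‖)⁻¹ • a)‖ + ‖y • ((‖a‖)⁻¹ • a - (‖b‖)⁻¹ • b)‖ := norm_add_le _ _
    _ ≤ δ + 2 * δ := add_le_add h1 h2
    _ = 3 * ‖a - b‖ ^ ((3 : ℝ)⁻¹) := by rw [hδ]; ring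

end CubeRootMap

/-! ## 3. Jensen for the cube root and mean control -/

section Mean

variable {d : Type*} [Fintype d]

/-- `∫ f^{1/3} ≤ (∫ f)^{1/3}` for a continuous `f ≥ 0` on `T^d` (AM–GM `f^{1/3} ≤ f/(3t²) + 2t/3`).
[folklore] -/
theorem integral_cbrt_le {f : UnitAddTorus d → ℝ} (hf : Continuous f) (h0 : ∀ x, 0 ≤ f x) :
    ∫ x, (f x) ^ ((3 : ℝ)⁻¹) ≤ (∫ x, f x) ^ ((3 : ℝ)⁻¹) := by
  have hI0 : 0 ≤ ∫ x, f x := integral_nonneg h0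
  have hint : Integrable f volume := hf.integrable_unitAddTorus
  have hcb : Continuous fun x => (f x) ^ ((3 : ℝ)⁻¹) :=
    hf.rpow_const fun x => Or.inr (by norm_num)
  have hsint : Integrable (fun x => (f x) ^ ((3 : ℝ)⁻¹)) volume := hcb.integrable_unitAddTorus
  have step : ∀ t : ℝ, 0 < t → ∫ x, (f x) ^ ((3 : ℝ)⁻¹) ≤ (∫ x, f x) / (3 * t ^ 2) + 2 * t / 3 := by
    intro t ht
    have hpt : ∀ x, (f x) ^ ((3 : ℝ)⁻¹) ≤ f x / (3 * t ^ 2) + 2 * t / 3 := by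
      intro x
      set r := (f x) ^ ((3 : ℝ)⁻¹) with hr
      have hr0 : 0 ≤ r := Real.rpow_nonneg (h0 x) _
      have hr3 : r ^ 3 = f x := cbrt_pow_three (h0 x)
      rw [← hr3, div_add_div _ _ (by positivity) (by norm_num), le_div_iff₀ (by positivity)]
      nlinarith [mul_nonneg (sq_nonneg (r - t)) (by positivity : (0 : ℝ) ≤ r + 2 * t)]
    calc ∫ x, (f x) ^ ((3 : ℝ)⁻¹) ≤ ∫ x, (f x / (3 * t ^ 2) + 2 * t / 3) :=
          integral_mono hsint ((hint.div_const _).add (integrable_const _)) hpt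
      _ = (∫ x, f x) / (3 * t ^ 2) + 2 * t / 3 := by
          rw [integral_add (hint.div_const _) (integrable_const _), integral_div, integral_const]
          simp
  refine le_of_forall_pos_lt_add fun η hη => ?_
  set m := (∫ x, f x) ^ ((3 : ℝ)⁻¹) with hm
  have hm0 : 0 ≤ m := Real.rpow_nonneg hI0 _
  have hm3 : m ^ 3 = ∫ x, f x := cbrt_pow_three hI0
  have h := step (m + η) (by positivity)
  have h1 : (∫ x, f x) / (3 * (m + η) ^ 2) ≤ m / 3 := by
    rw [← hm3, div_le_div_iff₀ (by positivity) (by norm_num)]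
    nlinarith [mul_nonneg hm0 hη.le, sq_nonneg η, mul_nonneg (mul_nonneg hm0 hm0) hη.le]
  linarith

/-- **Mean control at `a = 2`.** For a continuous zero-mean field `u` on `T^d`, `W := ‖u‖²u` and
`c := ∫ W`: `‖c‖² ≤ 729 ∫ ‖W − c‖²` (from `g(c) = ∫ (g c − g(W))`, the `⅓`-Hölder bound of `g`
and Jensen twice). [ours; elementary] -/
theorem norm_sq_integral_normSq_smul_le {u : UnitAddTorus d → EuclideanSpace ℝ d} (hu : Continuous u)
    (h0 : ∫ x, u x = 0) :
    ‖∫ x, ‖u x‖ ^ 2 • u x‖ ^ 2 ≤ 729 * ∫ x, ‖‖u x‖ ^ 2 • u x - ∫ y, ‖u y‖ ^ 2 • u y‖ ^ 2 := by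
  set W : UnitAddTorus d → EuclideanSpace ℝ d := fun x => ‖u x‖ ^ 2 • u x with hW
  set c : EuclideanSpace ℝ d := ∫ x, W x with hc
  have hWc : Continuous W := (hu.norm.pow 2).smul hu
  set g : EuclideanSpace ℝ d → EuclideanSpace ℝ d :=
    fun w => (‖w‖ ^ ((3 : ℝ)⁻¹)) • ((‖w‖)⁻¹ • w) with hgdef
  have hg : g c = ∫ x, (g c - g (W x)) := by
    have e : (fun x => g c - g (W x)) = fun x => g c - u x := by
      funext x; rw [hW, hgdef]; simp only; rw [cubeRootMap_normSq_smul]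
    rw [e, integral_sub (integrable_const _) hu.integrable_unitAddTorus, h0, sub_zero,
      integral_const]
    simp
  have hdc : Continuous fun x => ‖W x - c‖ := (hWc.sub continuous_const).norm
  have h1 : ‖c‖ ^ ((3 : ℝ)⁻¹) ≤ 3 * ∫ x, ‖W x - c‖ ^ ((3 : ℝ)⁻¹) := by
    have hn : ‖g c‖ = ‖c‖ ^ ((3 : ℝ)⁻¹) := norm_cubeRootMap c
    rw [← hn, hg]
    calc ‖∫ x, (g c - g (W x))‖ ≤ ∫ x, ‖g c - g (W x)‖ := norm_integral_le_integral_norm _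
      _ ≤ ∫ x, 3 * ‖W x - c‖ ^ ((3 : ℝ)⁻¹) := by
          refine integral_mono_of_nonneg (ae_of_all _ fun x => norm_nonneg _)
            (((hdc.rpow_const fun x => Or.inr (by norm_num)).const_mul 3).integrable_unitAddTorus)
            (ae_of_all _ fun x => ?_)
          have := norm_cubeRootMap_sub_le c (W x)
          rwa [← norm_sub_rev (W x) c] at this
      _ = 3 * ∫ x, ‖W x - c‖ ^ ((3 : ℝ)⁻¹) := integral_const_mul _ _
  -- Jensen twice: `∫ ‖W−c‖^{1/3} ≤ (∫‖W−c‖)^{1/3} ≤ (√V)^{1/3}`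
  have hV0 : 0 ≤ ∫ x, ‖W x - c‖ ^ 2 := integral_nonneg fun x => sq_nonneg _
  set s := Real.sqrt (∫ x, ‖W x - c‖ ^ 2) with hs
  have hs0 : 0 ≤ s := Real.sqrt_nonneg _
  have h2 : ∫ x, ‖W x - c‖ ^ ((3 : ℝ)⁻¹) ≤ s ^ ((3 : ℝ)⁻¹) :=
    (integral_cbrt_le hdc fun x => norm_nonneg _).trans
      (Real.rpow_le_rpow (integral_nonneg fun x => norm_nonneg _)
        (VelocityL4.integral_le_sqrt_integral_sq hdc) (by norm_num))
  -- cube both sides: `‖c‖ ≤ 27 s`, then square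
  set r := ‖c‖ ^ ((3 : ℝ)⁻¹) with hr
  set σ := s ^ ((3 : ℝ)⁻¹) with hσ
  have hr0 : 0 ≤ r := Real.rpow_nonneg (norm_nonneg _) _
  have hσ0 : 0 ≤ σ := Real.rpow_nonneg hs0 _
  have hr3 : r ^ 3 = ‖c‖ := cbrt_pow_three (norm_nonneg _)
  have hσ3 : σ ^ 3 = s := cbrt_pow_three hs0
  have hrσ : r ≤ 3 * σ := by linarith
  have hc27 : ‖c‖ ≤ 27 * s := by
    rw [← hr3, ← hσ3]
    calc r ^ 3 ≤ (3 * σ) ^ 3 := pow_le_pow_left₀ hr0 hrσ 3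
      _ = 27 * σ ^ 3 := by ring
  have hs2 : s ^ 2 = ∫ x, ‖W x - c‖ ^ 2 := Real.sq_sqrt hV0
  calc ‖c‖ ^ 2 ≤ (27 * s) ^ 2 := pow_le_pow_left₀ (norm_nonneg _) hc27 2
    _ = 729 * ∫ x, ‖W x - c‖ ^ 2 := by rw [mul_pow, hs2]; norm_num

end Mean

end VelocityL6

end Summit.NavierStokesRegularity.FunctionalMining
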